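import Mathlib
import Literature.MathematicalPhysics.QuantumFieldTheory.OSSectorContinuation
import Literature.MathematicalPhysics.QuantumFieldTheory.OSReconstructionNoE1Proofs
import HarnessLib

/-!
# Disc sections of a bounded sector extension (stub `stub_discSections_of_sectorExtension`,
crux `PlanarSpectralCone`)

Line `two-mirror-lightcone-slots` of crux `MirrorModularBoosts.PlanarSpectralCone`
(stmt-QuantumFields-9664), BACK END, first half (Thales + the `e₀` read-back).

Informal statement. Let `S` be a one-species Schwinger family on `ℝ⁴` with reflection positivity
and translation invariance on `⁰𝒮`, `h` its Osterwalder–Schrader reconstruction in the `e₀` frame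
(Hilbert space `ℋ`, field vectors `Ψ_G = h.fieldVec`, contraction semigroup `e^{-tH} = h.transfer t`,
unitary spatial translations `U(a⃗) = h.translate a`), and let `G` be a time-ordered test function.
In light-cone coordinates `(u, u')` of the `(x₀, x₁)`-plane write
`a(u,u') = ((u+u')/√2) e₀ + ((u−u')/√2) e₁` and `φ_G(u,u') = 𝔖_{2m}(ΘG* ⊗ G_{a(u,u')})`. Suppose
`Φ` is holomorphic on the two-slot sector region `{Re u, Re u' > 0, |arg u| + |arg u'| < π/2}`,
bounded by `M` there, and equal to `φ_G` on the open quadrant. Then for every `t > 0` the function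
`f(β) = Φ((t+β)/√2, (t−β)/√2)` is holomorphic on the disc `|β| < t`, bounded by `M` there, and
`f(b) = ⟪Ψ_G, e^{-tH} U(b e₁) Ψ_G⟫` for real `|b| < t`.

Proof. *Thales*: for `‖β‖ < t`, `β = b + iσ`, both `(t ± β)/√2` have positive real part `(t ± b)/√2`
and, with `|arg z| = arctan(|Im z| / Re z)` for `Re z > 0`,
`|arg((t+β)/√2)| + |arg((t−β)/√2)| = arctan(|σ|/(t+b)) + arctan(|σ|/(t−b)) < π/2` because the
product of the two arguments of `arctan` is `σ²/(t² − b²) < 1`, i.e. `b² + σ² < t²` — the disc. So the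
affine map `β ↦ ((t+β)/√2, (t−β)/√2)` sends the disc into the sector region, and `f = Φ ∘ (that map)`
is holomorphic and bounded by `M` there. *Read-back*: at a real `b` with `|b| < t` the point is the
positive real pair `u = (t+b)/√2`, `u' = (t−b)/√2` with `(u+u')/√2 = t`, `(u−u')/√2 = b`, so
`f(b) = φ_G(u,u') = 𝔖_{2m}(ΘG* ⊗ G_{t e₀ + b e₁}) = ⟪Ψ_G, e^{-tH} U(b e₁) Ψ_G⟫` by
`e^{-tH} Ψ_G = Ψ_{G_{t e₀}}`, `U(a⃗) Ψ_G = Ψ_{G_{a⃗}}` and `⟪Ψ_F, Ψ_G⟫ = 𝔖(ΘF* ⊗ G)`.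

References: K. Osterwalder, R. Schrader, Comm. Math. Phys. 31 (1973), §4.1 eqs. (4.4)–(4.6) (the
operators `e^{-tH}`, `U(a⃗)` on field vectors); K. Osterwalder, R. Schrader, Comm. Math. Phys. 42
(1975), Ch. V.1 (the sector region `{∑ |arg wⱼ| < π/2}`); the Thales computation is folklore.
-/

noncomputable section

namespace Summit.QuantumFields.YangMills.Cruxes.PlanarSpectralCone.TwoMirrorLightconeSlots

open MeasureTheory Complex Set Filter
open scoped InnerProductSpace ComplexConjugate
open Literature.MathematicalPhysics.QuantumLattice Literature.MathematicalPhysics.AQFT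
  Literature.MathematicalPhysics.QuantumFieldTheory

local notation "E4" => EuclideanSpace ℝ (Fin 4)

/-! ## Thales: the `ζ = t` slice of the two-slot sector region is the disc `|β| < t`

The helpers live in the sub-namespace `DiscSections` (no collisions with sibling stub files). -/

namespace DiscSections

/-- For `Re z > 0` the argument of `z` is `arctan (Im z / Re z)`. -/
theorem arg_eq_arctan_of_re_pos {z : ℂ} (hz : 0 < z.re) :
    Complex.arg z = Real.arctan (z.im / z.re) := by
  have h1 : |Complex.arg z| < Real.pi / 2 := Complex.abs_arg_lt_pi_div_two_iff.2 (Or.inl hz)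
  rw [abs_lt] at h1
  rw [← Complex.tan_arg, Real.arctan_tan h1.1 h1.2]

/-- `|arctan x| = arctan |x|` (`arctan` is odd and increasing). -/
theorem abs_arctan (x : ℝ) : |Real.arctan x| = Real.arctan |x| := by
  rcases le_total 0 x with hx | hx
  · rw [abs_of_nonneg hx, abs_of_nonneg (Real.arctan_nonneg.2 hx)]
  · rw [abs_of_nonpos hx, abs_of_nonpos (Real.arctan_le_zero.2 hx), Real.arctan_neg]

/-- For `Re z > 0`, `|arg z| = arctan (|Im z| / Re z)`. -/
theorem abs_arg_eq_arctan_of_re_pos {z : ℂ} (hz : 0 < z.re) :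
    |Complex.arg z| = Real.arctan (|z.im| / z.re) := by
  rw [arg_eq_arctan_of_re_pos hz, abs_arctan, abs_div, abs_of_pos hz]

/-- **Two-slot angle budget.** If `Re u, Re v > 0` and `|Im u| |Im v| < Re u · Re v` then
`|arg u| + |arg v| < π/2` (`arctan x + arctan y < π/2` for `xy < 1`). -/
theorem abs_arg_add_abs_arg_lt {u v : ℂ} (hu : 0 < u.re) (hv : 0 < v.re)
    (h : |u.im| * |v.im| < u.re * v.re) :
    |Complex.arg u| + |Complex.arg v| < Real.pi / 2 := by
  rw [abs_arg_eq_arctan_of_re_pos hu, abs_arg_eq_arctan_of_re_pos hv]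
  refine Real.arctan_add_arctan_lt_pi_div_two ?_
  rw [div_mul_div_comm, div_lt_one (mul_pos hu hv)]
  exact h

/-- **Thales.** For `‖β‖ < t` (so `t > 0`) the light-cone coordinates `((t+β)/√2, (t−β)/√2)` of the
point `(ζ, β) = (t, β)` lie in the two-slot sector region
`{Re u, Re u' > 0, |arg u| + |arg u'| < π/2}`: both real parts are `(t ± Re β)/√2 > 0`, and the angle
budget holds because `(Im β)² < (t + Re β)(t − Re β)`, i.e. `‖β‖² < t²`. -/
theorem lightCone_mem_sectorRegion {t : ℝ} {β : ℂ} (hβ : ‖β‖ < t) :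
    (![((t : ℂ) + β) / (Real.sqrt 2 : ℂ), ((t : ℂ) - β) / (Real.sqrt 2 : ℂ)] : Fin 2 → ℂ) ∈
      Literature.Analysis.Complex.sectorRegion 1 (Real.pi / 2) := by
  have hs : 0 < Real.sqrt 2 := Real.sqrt_pos.2 two_pos
  set u : ℂ := ((t : ℂ) + β) / (Real.sqrt 2 : ℂ) with hu
  set u' : ℂ := ((t : ℂ) - β) / (Real.sqrt 2 : ℂ) with hu'
  have hre : |β.re| < t := lt_of_le_of_lt (Complex.abs_re_le_norm β) hβ
  rw [abs_lt] at hre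
  have hure : u.re = (t + β.re) / Real.sqrt 2 := by rw [hu, Complex.div_ofReal_re]; simp
  have huim : u.im = β.im / Real.sqrt 2 := by rw [hu, Complex.div_ofReal_im]; simp
  have hu're : u'.re = (t - β.re) / Real.sqrt 2 := by rw [hu', Complex.div_ofReal_re]; simp
  have hu'im : u'.im = (-β.im) / Real.sqrt 2 := by rw [hu', Complex.div_ofReal_im]; simp
  have hupos : 0 < u.re := by rw [hure]; exact div_pos (by linarith) hs
  have hu'pos : 0 < u'.re := by rw [hu're]; exact div_pos (by linarith) hs
  have key : |β.im| * |β.im| < (t + β.re) * (t - β.re) := by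
    have h1 : ‖β‖ ^ 2 < t ^ 2 := pow_lt_pow_left₀ hβ (norm_nonneg _) two_ne_zero
    rw [Complex.sq_norm, Complex.normSq_apply] at h1
    rw [abs_mul_abs_self]
    nlinarith [h1]
  have hprod : |u.im| * |u'.im| < u.re * u'.re := by
    rw [huim, hu'im, hure, hu're, abs_div, abs_div, abs_neg, abs_of_pos hs, div_mul_div_comm,
      div_mul_div_comm]
    exact div_lt_div_of_pos_right key (mul_pos hs hs)
  have hmem : ((![u, u'] : Fin 2 → ℂ) ∈ Literature.Analysis.Complex.sectorRegion 1 (Real.pi / 2)) ↔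
      ((0 < u.re ∧ 0 < u'.re) ∧ |Complex.arg u| + |Complex.arg u'| < Real.pi / 2) := by
    show ((∀ j : Fin 2, 0 < ((![u, u'] : Fin 2 → ℂ) j).re) ∧
        ∑ j : Fin 2, |Complex.arg ((![u, u'] : Fin 2 → ℂ) j)| < Real.pi / 2) ↔ _
    rw [Fin.sum_univ_two, Fin.forall_fin_two]
    simp
  rw [hmem]
  exact ⟨⟨hupos, hu'pos⟩, abs_arg_add_abs_arg_lt hupos hu'pos hprod⟩

/-- The light-cone coordinate map `β ↦ ((t+β)/√2, (t−β)/√2)` is holomorphic (it is affine). -/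
theorem differentiable_lightCone (t : ℝ) :
    Differentiable ℂ fun β : ℂ =>
      (![((t : ℂ) + β) / (Real.sqrt 2 : ℂ), ((t : ℂ) - β) / (Real.sqrt 2 : ℂ)] : Fin 2 → ℂ) := by
  refine differentiable_pi.2 fun j => ?_
  fin_cases j
  · simp only [Fin.zero_eta, Fin.isValue, Matrix.cons_val_zero]
    fun_prop
  · simp only [Fin.mk_one, Fin.isValue, Matrix.cons_val_one, Matrix.cons_val_fin_one]
    fun_prop

/-- At a real `b` the light-cone coordinates are the real pair `((t+b)/√2, (t−b)/√2)`. -/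
theorem lightCone_ofReal (t b : ℝ) :
    (![((t : ℂ) + (b : ℂ)) / (Real.sqrt 2 : ℂ), ((t : ℂ) - (b : ℂ)) / (Real.sqrt 2 : ℂ)] : Fin 2 → ℂ) =
      fun j => (((![(t + b) / Real.sqrt 2, (t - b) / Real.sqrt 2] : Fin 2 → ℝ) j : ℝ) : ℂ) := by
  funext j
  fin_cases j
  · simp only [Fin.zero_eta, Fin.isValue, Matrix.cons_val_zero]
    push_cast
    ring
  · simp only [Fin.mk_one, Fin.isValue, Matrix.cons_val_one, Matrix.cons_val_fin_one]
    push_cast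
    ring

/-- The real light-cone pair of `(t, b)` with `|b| < t` lies in the open quadrant. -/
theorem lightCone_real_pos {t b : ℝ} (hb : |b| < t) :
    ∀ j, 0 < (![(t + b) / Real.sqrt 2, (t - b) / Real.sqrt 2] : Fin 2 → ℝ) j := by
  have hs : 0 < Real.sqrt 2 := Real.sqrt_pos.2 two_pos
  rw [abs_lt] at hb
  intro j
  fin_cases j
  · simp only [Fin.zero_eta, Fin.isValue, Matrix.cons_val_zero]
    exact div_pos (by linarith) hs
  · simp only [Fin.mk_one, Fin.isValue, Matrix.cons_val_one, Matrix.cons_val_fin_one]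
    exact div_pos (by linarith) hs

/-- Inverting the light-cone coordinates: `(u + u')/√2 = t` for `u = (t+b)/√2`, `u' = (t−b)/√2`. -/
theorem lightCone_real_sum (t b : ℝ) :
    ((t + b) / Real.sqrt 2 + (t - b) / Real.sqrt 2) / Real.sqrt 2 = t := by
  rw [← add_div, div_div, Real.mul_self_sqrt two_pos.le]
  ring

/-- Inverting the light-cone coordinates: `(u − u')/√2 = b` for `u = (t+b)/√2`, `u' = (t−b)/√2`. -/
theorem lightCone_real_sub (t b : ℝ) :
    ((t + b) / Real.sqrt 2 - (t - b) / Real.sqrt 2) / Real.sqrt 2 = b := by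
  rw [← sub_div, div_div, Real.mul_self_sqrt two_pos.le]
  ring

/-! ## The `e₀` read-back of a translated diagonal pairing -/

/-- Time-then-space translation is the single translation by `t e₀ + b e₁`. -/
theorem translateMulti_time_space {m : ℕ} (t b : ℝ) (G : SchwartzMap (Fin m → E4) ℂ) :
    translateMulti (SchwingerFamily.timeVec t)
        (translateMulti (spatialPart 0 (b • (EuclideanSpace.single 1 1 : E4))) G) =
      translateMulti (t • EuclideanSpace.single 0 1 + b • EuclideanSpace.single 1 1) G := by
  have hv : (SchwingerFamily.timeVec t + spatialPart 0 (b • (EuclideanSpace.single 1 1 : E4)) : E4) =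
      t • EuclideanSpace.single 0 1 + b • EuclideanSpace.single 1 1 := by
    ext i
    fin_cases i <;> simp [SchwingerFamily.timeVec, spatialPart_apply]
  rw [translateMulti_translateMulti, hv]

/-- **Read-back of a translated diagonal pairing**: for time-ordered `A`, `B` in the OS space of the
labelled one-species family `S'.toLabelled`,
`𝔖'_{n+m}(ΘA* ⊗ B_{t e₀ + b e₁}) = ⟪Ψ_A, e^{-tH} U(b e₁) Ψ_B⟫` (`t ≥ 0`). -/
theorem pairing_eq_inner_transfer_translate (S' : SchwingerFamily E4)
    (h' : OSReconstructionNoE1 S'.toLabelled)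
    {n m : ℕ} (A : SchwartzMap (Fin n → E4) ℂ) (B : SchwartzMap (Fin m → E4) ℂ)
    (hA : IsTimeOrdered A) (hB : IsTimeOrdered B) {t : ℝ} (ht : 0 ≤ t) (b : ℝ) :
    S' (n + m) ((osAdjoint A).appendTensor
        (translateMulti (t • EuclideanSpace.single 0 1 + b • EuclideanSpace.single 1 1) B)) =
      ⟪h'.fieldVec n (fun _ => ()) A hA,
        h'.transfer t (h'.translate (b • EuclideanSpace.single 1 1) (h'.fieldVec m (fun _ => ()) B hB))⟫_ℂ := by
  rw [OSReconstructionNoE1.translate_fieldVec, OSReconstructionNoE1.transfer_fieldVec _ ht]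
  have hH : IsAppendTensorOf ((osAdjoint A).appendTensor
      (translateMulti (t • EuclideanSpace.single 0 1 + b • EuclideanSpace.single 1 1) B)) (osAdjoint A)
      (translateMulti (SchwingerFamily.timeVec t)
        (translateMulti (spatialPart 0 (b • (EuclideanSpace.single 1 1 : E4))) B)) := by
    rw [translateMulti_time_space]; exact isAppendTensorOf_appendTensor _ _
  rw [h'.inner_fieldVec_fieldVec (fun _ => ()) (fun _ => ()) hA _ hH]
  rfl

end DiscSections

/-! ## The stub -/

/-- **BACK END, first half — a bounded sector extension gives disc sections (Thales).** In the
`e₀`-frame reconstruction `h` of `S`, let `G` be time-ordered and let `Φ` be holomorphic on the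
two-slot sector region `{Re u, Re u' > 0, |arg u| + |arg u'| < π/2}`, bounded by `M` there, and equal
to `φ_G(u,u') = 𝔖_{2m}(ΘG* ⊗ G_{a(u,u')})` on the open quadrant. Then for every `t > 0` the function
`f(β) = Φ((t+β)/√2, (t−β)/√2)` is holomorphic on the disc `|β| < t`, bounded by `M`, and equals
`⟪Ψ_G, e^{-tH} U(b e₁) Ψ_G⟫` at real `|b| < t`. Proof: `DiscSections.lightCone_mem_sectorRegion`
(Thales) for holomorphy and the bound; at real `b` the point is the positive real pair
`((t+b)/√2, (t−b)/√2)` with `(u+u')/√2 = t`, `(u−u')/√2 = b`, and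
`DiscSections.pairing_eq_inner_transfer_translate` reads `𝔖_{2m}(ΘG* ⊗ G_{t e₀ + b e₁})` back as
`⟪Ψ_G, e^{-tH} U(b e₁) Ψ_G⟫`. -/
theorem stub_discSections_of_sectorExtension
    (S : SchwingerFamily E4) (h : OSReconstructionNoE1 S.toLabelled)
    {m : ℕ} (G : SchwartzMap (Fin m → E4) ℂ) (hG : IsTimeOrdered G)
    (M : ℝ) (Φ : (Fin 2 → ℂ) → ℂ)
    (hΦd : DifferentiableOn ℂ Φ (Literature.Analysis.Complex.sectorRegion 1 (Real.pi / 2)))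
    (hΦb : ∀ w ∈ Literature.Analysis.Complex.sectorRegion 1 (Real.pi / 2), ‖Φ w‖ ≤ M)
    (hΦr : ∀ u : Fin 2 → ℝ, (∀ j, 0 < u j) →
      Φ (fun j => (u j : ℂ)) = S (m + m) ((osAdjoint G).appendTensor
        (translateMulti (((u 0 + u 1) / Real.sqrt 2) • EuclideanSpace.single 0 1 +
          ((u 0 - u 1) / Real.sqrt 2) • EuclideanSpace.single 1 1) G))) :
    ∀ t : ℝ, 0 < t → ∃ f : ℂ → ℂ, DifferentiableOn ℂ f (Metric.ball 0 t) ∧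
      (∀ z ∈ Metric.ball (0 : ℂ) t, ‖f z‖ ≤ M) ∧
      ∀ b : ℝ, |b| < t → f b = ⟪h.fieldVec m (fun _ => ()) G hG,
        h.transfer t (h.translate (b • EuclideanSpace.single 1 1) (h.fieldVec m (fun _ => ()) G hG))⟫_ℂ := by
  intro t ht
  -- the light-cone coordinate map of the slice `ζ = t`
  set g : ℂ → (Fin 2 → ℂ) := fun β =>
    (![((t : ℂ) + β) / (Real.sqrt 2 : ℂ), ((t : ℂ) - β) / (Real.sqrt 2 : ℂ)] : Fin 2 → ℂ) with hg
  have hmaps : MapsTo g (Metric.ball (0 : ℂ) t)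
      (Literature.Analysis.Complex.sectorRegion 1 (Real.pi / 2)) := by
    intro β hβ
    rw [Metric.mem_ball, dist_zero_right] at hβ
    exact DiscSections.lightCone_mem_sectorRegion hβ
  have hgd : Differentiable ℂ g := DiscSections.differentiable_lightCone t
  refine ⟨Φ ∘ g, hΦd.comp hgd.differentiableOn hmaps, fun z hz => hΦb _ (hmaps hz), ?_⟩
  intro b hb
  have hgb : g b = fun j =>
      (((![(t + b) / Real.sqrt 2, (t - b) / Real.sqrt 2] : Fin 2 → ℝ) j : ℝ) : ℂ) :=
    DiscSections.lightCone_ofReal t b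
  show Φ (g b) = _
  rw [hgb, hΦr _ (DiscSections.lightCone_real_pos hb)]
  simp only [Matrix.cons_val_zero, Matrix.cons_val_one, Matrix.cons_val_fin_one]
  rw [DiscSections.lightCone_real_sum, DiscSections.lightCone_real_sub]
  exact DiscSections.pairing_eq_inner_transfer_translate S h G G hG hG ht.le b

end Summit.QuantumFields.YangMills.Cruxes.PlanarSpectralCone.TwoMirrorLightconeSlots
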